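import Literature.Computability.AlgebraicComplexity.MatrixMultiplicationExponent
import HarnessLib

/-!
# MatrixMultiplication — problem statement (D-0013, tier 2; operator-created)

`ω = 2`: the exponent of matrix multiplication
`ω(ℂ) = inf {β ∈ ℝ | R(⟨n,n,n⟩) = O(n^β)}` (Bläser 2013, Def. 5.1; `R` = tensor rank, §4) equals `2`.
Equivalently (Bläser 2013, Thm. 5.2, `K` infinite) for every `ε > 0` the `n × n` matrix product over
`ℂ` is computable with `O(n^{2+ε})` arithmetic operations. An infimum: NO `O(n²)` algorithm is
asserted. The field is fixed to `ℂ` (Bläser: "indeterminates over some field K"; `ω(K)` is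
invariant under field extension, hence depends only on the characteristic — Schönhage 1981,
Bürgisser–Clausen–Shokrollahi 1997 §15 — so `ω(ℂ) = ω(ℚ) = ω(K)` for every `K` of
characteristic `0`; a Literature theorem, not used here); the all-fields form is
`Literature.Computability.AlgebraicComplexity.MatrixMultiplicationAllFields` (implies this one).

The definitions (`triad`, `tensorRank`, `matMulTensor`, `admissibleExponents`, `omega`) live in
`Literature/Computability/AlgebraicComplexity/MatrixMultiplicationExponent.lean`; this file
imports the conjunct `Literature.CplxAlg.MatrixMultiplication := omega ℂ = 2`, not restated.

Well-definedness (audit 2026-08-13): `admissibleExponents ℂ` is non-empty (`3 ∈`, tree) and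
bounded below by `0` (`R(⟨n,n,n⟩) ≥ 1` for `n ≥ 1`; audit Scratch.lean, sorry-free), so the `sInf`
is a genuine infimum, `0 ≤ ω(ℂ) ≤ 3`; `ω(ℂ) ≥ 2` is the flattening bound `R(⟨n,n,n⟩) ≥ n²`
(Literature, to be vendored).
-/

/-- **MatrixMultiplication** (`ω = 2`, over `ℂ`; Bläser 2013, Def. 5.1 with §9.2/§10): the
exponent of matrix multiplication `ω(ℂ) = inf {β | R(⟨n,n,n⟩) = O(n^β)}` equals `2`. The
Literature statement `Literature.Computability.AlgebraicComplexity.MatrixMultiplication`, imported not restated.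
[cite: Blaser2013, Def. 5.1] [problem: MatrixMultiplication] -/
def MatrixMultiplication : Prop := Literature.Computability.AlgebraicComplexity.MatrixMultiplication

/-- Unfolding: the summit is literally `ω(ℂ) = 2`. [folklore] -/
theorem MatrixMultiplication_iff : MatrixMultiplication ↔ Literature.Computability.AlgebraicComplexity.omega ℂ = 2 := Iff.rfl
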